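import Summits.HodgeConjecture.CorCM.HypLiu418.A3Liu418BettiThetaModelAtPlace
import Summits.HodgeConjecture.CorCM.HypLiu418.OffPlaceFace
import HarnessLib

/-!
# Line `a3-liu418`, stub P OFF PLACE — the Weil-carrier side (B)(i): transport of `BettiThetaDecomposition` across a same-Gram re-reading of the face

Cell `hodgecm-mathlib`, fan A, rung A-III; Summits lane `CorCM/HypLiu418/`; seat A-p12 (g2); plan FILE C of A-p08's END FILE PLAN v1
(2026-08-28T04:39:11Z, APPROVED director g2 04:40:51Z) for the registered residual `stub_bettiThetaModel_offPlace` of the crux skeleton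
`Cruxes/HLiu418/Lines/a3_liu418.lean` v4 (item `stmt-HodgeConjecture-24832`).

THE POINT (A-p12 REPORT-FIRST 04:46Z).  At an off-place face `(ι₁, V)` the END's at-place junction is applied to the SAME Gram matrix read at
the conjugate embedding, `V₀ := ⟨V.Hm, V.isHermitian, _, _⟩ : HodgeCM.HermSpace3 F ι'` (`ι' = conj ∘ ι₁`; A-p08's `HermSpace3.alongConj`).
The rational frame of record is `V.exists_rational_frame.choose`, an existential that mentions `V` only through `V.Hm`
(`HodgeCM/Model/Junction/RationalFrame.lean`), so by proof irrelevance `frameD V₀`, `frameG V₀`, `V₀.adelicFin`, `ιVE V₀` are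
DEFINITIONALLY those of `V`; and the fields of `uniformOmegaRep` see `(ι, V, Φ)` only through types (`Item6UniformOmegaRep.lean`), `muConj`
is fieldwise (`AdapterMuConj.lean`).  Hence the μ-uniform Weil carriers `muConj 𝕌_{V₀}` and `muConj 𝕌_V` of the two faces have the same
collections, characters, summands `ω(μ,ε,χ)` and actions — term by term, by `rfl` — and the ONLY parameter of
`BettiThetaDecomposition (muConj 𝕌) H rhoB` that differs between the two faces is the index TYPE `AdmTripleAll (C := ℭ_{V₀,Φ'}) _` versus
`AdmTripleAll (C := ℭ_{V,Φ}) _` (the structure parameter `C`, the face's own §4.2 datum).  No isometry of frames, no `OmegaTwist`.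

CONTENTS.  §1 (generic over two Appendix-C data `C`, `C'` with the same CM extension): `BettiThetaDecomposition.transport` — identifications of the
collections and characters compatible with `epsOf` re-index the labelled admissible triples (`AdmTripleAll.eq_of_μ_ε_χ`), and a
[Prop 4.13]-type decomposition of `(H, rhoB)` over `U` is carried to one of `(H, rhoB')` over `U'` along a group map `φ : C'.G →* C.G`
intertwining `rhoB'` with `rhoB`, given summand isomorphisms intertwining the actions (pure re-indexing of a direct sum:
`DirectSum.lequivCongrLeft` + componentwise `DirectSum.lmap`, the pattern of `Thm418Transport.thm418AsPrinted_transport`).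
§2 (END currency — the terms of the skeleton's face abbreviations `UV` ∕ `CV` verbatim, over ANY record-system witness `h`, the END's being `DelRec.exists_recordSystem_of_printed hDel`): `bettiThetaDecomposition_of_sameGram` ∕
`bettiThetaDecomposition_to_sameGram` — for ANY second embedding `ι'`, ANY proof fields `sig'`, `pos'` and ANY CM types `Φ`, `Φ'`, the
decomposition of a tower module `(H, rhoB)` over `muConj 𝕌` of the face `(ι', ⟨V.Hm, V.isHermitian, sig', pos'⟩, a, Φ')` is the SAME
statement as over `muConj 𝕌` of `(ι₁, V, a, Φ)` (all structure maps identities, every hypothesis of §1 closed by `rfl`).  Stated on the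
literal same-Gram structure, so that it applies to `V.alongConj` by unfolding, whatever its proof fields.  Theorems only; nothing of
[Liu2021] is asserted; HC_CM is proved only modulo the 7 printed citations until rung 0 closes.

## References
* [Liu2021] Y. Liu, *Fourier–Jacobi cycles and arithmetic relative trace formula*, Camb. J. Math. 9 (2021): Def. 4.11–4.12
  (FJcycle.tex l. 2083–2111), Prop. 4.13 (l. 2110–2131), Thm. 4.18 proof l. 2254–2257 (the decomposition is read on `H¹_{B,τ'}`;
  `Sh(V)` does not see which conjugate embedding names the archimedean place, §4.2 l. 2053–2060).
-/

set_option autoImplicit false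

noncomputable section

namespace Summit.HodgeConjecture.CorCM.Lines.A3Liu418

open scoped TensorProduct Matrix ComplexOrder DirectSum
open NumberField NumberField.InfinitePlace
open HodgeCM.Model HodgeCM.Model.LiuIndex HodgeCM.Model.TowerCarrier
open Summit.HodgeConjecture.CorCM.Model
open Literature.AlgebraicGeometry.Motives (CMType)
open Literature.AlgebraicGeometry.ShimuraVarieties.UnitaryCanonicalModel
open Literature.NumberTheory.ComplexMultiplication
open Literature.NumberTheory.Automorphic
open Literature.NumberTheory.Automorphic.IdeleClassGroup (toHeckeCharacter isUnitary_toHeckeCharacter galConj)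
open Literature.NumberTheory.Automorphic.Liu2021 Literature.NumberTheory.Automorphic.Liu2021.AppendixC
open Literature.NumberTheory.Automorphic.Liu2021.AppendixC.RestOne
open Literature.NumberTheory.Automorphic.Liu2021.Def411WeilCarriers (lineOf locF Rep)
open Summit.HodgeConjecture.CorCM.Transposition.OmegaTransport (realUnit)
open HodgeCM.Model.ArchSideTerm (e₁)
open Literature.NumberTheory.GelbartRogawski1991 Literature.NumberTheory.GelbartRogawski1991.UnitaryDualPair
open Literature.RepresentationTheory Literature.RepresentationTheory.Liu2021
open Summit.HodgeConjecture.CorCM.Transposition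
open Summit.HodgeConjecture.CorCM.D2Bridge.AdapterMuConj (muConj)

/-! ## §1. Re-indexing a [Prop 4.13]-type decomposition along identified carriers (generic) -/

section Generic

variable {F₀ E₀ : Type} [Field F₀] [NumberField F₀] [IsTotallyReal F₀] [Field E₀] [NumberField E₀] [Algebra F₀ E₀]
  [IsTotallyComplex E₀] [Algebra.IsQuadraticExtension F₀ E₀] [IsCMField E₀]
variable {P5 : PropC5Data F₀ E₀} {isotropicAt : ℕ → Prop} {C : Sec42Data P5 isotropicAt}
variable {P5' : PropC5Data F₀ E₀} {isotropicAt' : ℕ → Prop} {C' : Sec42Data P5' isotropicAt'}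

/-- Two labelled admissible triples with the same label, the same collection and the same character are equal (the other fields are
proofs). [cite: Liu2021, Def. 4.12 (l. 2102–2111)] -/
theorem AdmTripleAll.eq_of_μ_ε_χ {U : UniformOmega C} (t s : AdmTripleAll U) (h₁ : t.μ = s.μ) (h₂ : t.ε = s.ε) (h₃ : t.χ = s.χ) :
    t = s := by
  obtain ⟨μ, hμ, hw, ε, adm, χ⟩ := t
  obtain ⟨μ', hμ', hw', ε', adm', χ'⟩ := s
  cases h₁; cases h₂; cases h₃
  rfl

/-- **Transport of the [Prop 4.13] decomposition along identified carriers.**  Let `U`, `U'` be μ-uniform Weil carriers over two §4.2 data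
`C`, `C'`, `φ : C'.G →* C.G`, identifications `eEps`, `eChi` compatible with `epsOf`, and for every target label `(μ, ε', χ')` an isomorphism
`Ω : ω_U(μ, eEps⁻¹ ε', eChi⁻¹ χ') ≃ ω_{U'}(μ, ε', χ')` with `Ω (ρ_U(φ g) x) = ρ_{U'}(g) (Ω x)`.  If `(H, rhoB)` decomposes over `U` and
`rhoB' g = rhoB (φ g)`, then `(H, rhoB')` decomposes over `U'`: `H ≅ ⊕_t ω_U(t) ≅ ⊕_{t'} ω_U(e⁻¹ t') ≅ ⊕_{t'} ω_{U'}(t')` (re-index along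
the induced equivalence of `AdmTripleAll`, then `Ω` componentwise). [cite: Liu2021, Prop. 4.13 (FJcycle.tex l. 2110–2131); Thm. 4.18 proof l. 2254–2257] -/
theorem BettiThetaDecomposition.transport (U : UniformOmega C) (U' : UniformOmega C') (φ : C'.G →* C.G)
    (eEps : U.Eps ≃ U'.Eps) (eChi : U.Chi ≃ U'.Chi) (hEps : ∀ e, eEps (U.epsOf e) = U'.epsOf e)
    (Ω : ∀ (μ : Literature.NumberTheory.Automorphic.IdeleClassGroup E₀ →ₜ* Circle) (hμ : IdeleClassGroup.IsConjugateSymplectic E₀ μ)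
      (ε' : U'.Eps) (χ' : U'.Chi), U.omega μ hμ (eEps.symm ε') (eChi.symm χ') ≃ₗ[ℂ] U'.omega μ hμ ε' χ')
    (hΩ : ∀ (μ : Literature.NumberTheory.Automorphic.IdeleClassGroup E₀ →ₜ* Circle) (hμ : IdeleClassGroup.IsConjugateSymplectic E₀ μ)
      (ε' : U'.Eps) (χ' : U'.Chi) (g : C'.G) (x : U.omega μ hμ (eEps.symm ε') (eChi.symm χ')),
      Ω μ hμ ε' χ' (U.rho μ hμ (eEps.symm ε') (eChi.symm χ') (φ g) x) = U'.rho μ hμ ε' χ' g (Ω μ hμ ε' χ' x))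
    {H : Type} [AddCommGroup H] [Module ℂ H] {rhoB : Representation ℂ C.G H} {rhoB' : Representation ℂ C'.G H}
    (hB : ∀ (g : C'.G) (x : H), rhoB' g x = rhoB (φ g) x) :
    BettiThetaDecomposition U H rhoB → BettiThetaDecomposition U' H rhoB' := by
  classical
  rintro ⟨Ψ, hΨ⟩
  -- re-indexing of the labelled admissible triples (Def. 4.12's «`ε` is `μ`-admissible» is a condition on `epsOf`, preserved by `hEps`)
  let e : AdmTripleAll U ≃ AdmTripleAll U' :=
    { toFun := fun t => ⟨t.μ, t.hμ, t.hw, eEps t.ε, (by obtain ⟨e, he, h⟩ := t.adm; exact ⟨e, he, by rw [← hEps, h]⟩), eChi t.χ⟩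
      invFun := fun s => ⟨s.μ, s.hμ, s.hw, eEps.symm s.ε,
        (by obtain ⟨e, he, h⟩ := s.adm; exact ⟨e, he, by rw [← h, ← hEps, Equiv.symm_apply_apply]⟩), eChi.symm s.χ⟩
      left_inv := fun t => AdmTripleAll.eq_of_μ_ε_χ _ _ rfl (eEps.symm_apply_apply _) (eChi.symm_apply_apply _)
      right_inv := fun s => AdmTripleAll.eq_of_μ_ε_χ _ _ rfl (eEps.apply_symm_apply _) (eChi.apply_symm_apply _) }
  -- re-index the sum along `e`: the summand at `t'` becomes `ω_U(e⁻¹ t') = ω_U(t'.μ, eEps⁻¹ t'.ε, eChi⁻¹ t'.χ)` (by `rfl`)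
  let R : (⨁ t : AdmTripleAll U, U.omega t.μ t.hμ t.ε t.χ) ≃ₗ[ℂ]
      ⨁ t' : AdmTripleAll U', U.omega t'.μ t'.hμ (eEps.symm t'.ε) (eChi.symm t'.χ) :=
    DirectSum.lequivCongrLeft ℂ e
  -- then `Ω` componentwise
  let K : (⨁ t' : AdmTripleAll U', U.omega t'.μ t'.hμ (eEps.symm t'.ε) (eChi.symm t'.χ)) ≃ₗ[ℂ]
      ⨁ t' : AdmTripleAll U', U'.omega t'.μ t'.hμ t'.ε t'.χ :=
    LinearEquiv.ofLinear
      (DirectSum.lmap fun t' => (Ω t'.μ t'.hμ t'.ε t'.χ).toLinearMap)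
      (DirectSum.lmap fun t' => ((Ω t'.μ t'.hμ t'.ε t'.χ).symm).toLinearMap)
      (by
        apply LinearMap.ext
        intro x
        apply DFinsupp.ext
        intro t'
        simp only [LinearMap.comp_apply, DirectSum.lmap_apply, LinearEquiv.coe_coe, LinearEquiv.apply_symm_apply,
          LinearMap.id_apply])
      (by
        apply LinearMap.ext
        intro x
        apply DFinsupp.ext
        intro t'
        simp only [LinearMap.comp_apply, DirectSum.lmap_apply, LinearEquiv.coe_coe, LinearEquiv.symm_apply_apply,
          LinearMap.id_apply])
  have hR : ∀ (y : ⨁ t : AdmTripleAll U, U.omega t.μ t.hμ t.ε t.χ) (t' : AdmTripleAll U'), R y t' = y (e.symm t') :=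
    fun y t' => DirectSum.lequivCongrLeft_apply _ _ _ _
  have hK : ∀ (z : ⨁ t' : AdmTripleAll U', U.omega t'.μ t'.hμ (eEps.symm t'.ε) (eChi.symm t'.χ)) (t' : AdmTripleAll U'),
      K z t' = Ω t'.μ t'.hμ t'.ε t'.χ (z t') := fun z t' => by
    simp only [K, LinearEquiv.ofLinear_apply, DirectSum.lmap_apply, LinearEquiv.coe_coe]
  let Ψ' : H ≃ₗ[ℂ] ⨁ t' : AdmTripleAll U', U'.omega t'.μ t'.hμ t'.ε t'.χ := Ψ ≪≫ₗ R ≪≫ₗ K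
  have hΨ' : ∀ (x : H) (t' : AdmTripleAll U'), Ψ' x t' = Ω t'.μ t'.hμ t'.ε t'.χ (Ψ x (e.symm t')) := fun x t' => by
    show K (R (Ψ x)) t' = _
    rw [hK, hR]
  refine ⟨Ψ', fun g x t' => ?_⟩
  rw [hΨ', hΨ', hB, hΨ]
  exact hΩ t'.μ t'.hμ t'.ε t'.χ g (Ψ x (e.symm t'))

end Generic

/-! ## §2. The off-place face: same Gram matrix, another embedding — the carriers coincide (END currency) -/

section SameGram

variable (h : exists_recordSystem) (F : HodgeCM.CMField) [IsGalois ℚ F] {ι₁ ι' : (F : Type) →+* ℂ} (V : HodgeCM.HermSpace3 F ι₁)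
  (sig' : ∃ T : GL (Fin 3) ℂ, (T : Matrix (Fin 3) (Fin 3) ℂ)ᴴ * V.Hm.map ι' * (T : Matrix (Fin 3) (Fin 3) ℂ) =
      Literature.AlgebraicGeometry.ShimuraVarieties.signatureMatrix 2)
  (pos' : ∀ τ : (F : Type) →+* ℂ, InfinitePlace.mk τ ≠ InfinitePlace.mk ι' → (V.Hm.map τ).PosDef)
  (a : RealScalar F) (Φ Φ' : CMType F) (H : Type) [AddCommGroup H] [Module ℂ H]

set_option synthInstance.maxHeartbeats 400000 in
set_option maxHeartbeats 4000000 in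
-- (every structure map is an identity; the hypotheses of `BettiThetaDecomposition.transport` are closed by `rfl` — the two faces' carriers
-- are the same terms: `frameD`, `frameG`, `ιVE`, `adelicFin` agree by proof irrelevance through `exists_rational_frame.choose`)
/-- **Stub P's Weil-carrier side OFF PLACE.**  For the same Gram matrix `V.Hm` read at ANY second embedding `ι'` (with any proof fields
`sig'`, `pos'` — e.g. A-p08's `V.alongConj` at `ι' = conj ∘ ι₁`) and ANY CM types `Φ`, `Φ'`: a [Prop 4.13] decomposition of a tower module
`(H, rhoB)` over the `ν ↦ νᶜ`-relabelled μ-uniform family `muConj 𝕌` of the face `(ι', ⟨V.Hm, V.isHermitian, sig', pos'⟩, a, Φ')` IS one over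
`muConj 𝕌` of the face `(ι₁, V, a, Φ)` — the two families have the same collections, characters, summands and actions term by term (the
rational frame of record, `ιVE` and `𝔾(𝔸_F^∞) = U(V.Hm)(𝔸_f)` depend on `V` only through `V.Hm`), so only the index type of the direct sum is
re-read (`BettiThetaDecomposition.transport` with identities). [cite: Liu2021, Prop. 4.13 (FJcycle.tex l. 2110–2131); Def. 4.11–4.12; §4.2 l. 2053–2060] -/
theorem bettiThetaDecomposition_of_sameGram
    (rhoB : Representation ℂ (sec42DataOf h isoOf ⟨HodgeCM.CMField.K F⟩ ι₁ ⟨HodgeCM.HermSpace3.Hm V, HodgeCM.HermSpace3.isHermitian V, HodgeCM.HermSpace3.signature_ι₁ V, HodgeCM.HermSpace3.posDef_of_ne V⟩ Φ).G H) :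
    BettiThetaDecomposition (Summit.HodgeConjecture.CorCM.D2Bridge.AdapterMuConj.muConj (uniformOmegaRep h ⟨HodgeCM.CMField.K F⟩ ι' ⟨HodgeCM.HermSpace3.Hm (⟨V.Hm, V.isHermitian, sig', pos'⟩ : HodgeCM.HermSpace3 F ι'), HodgeCM.HermSpace3.isHermitian (⟨V.Hm, V.isHermitian, sig', pos'⟩ : HodgeCM.HermSpace3 F ι'), HodgeCM.HermSpace3.signature_ι₁ (⟨V.Hm, V.isHermitian, sig', pos'⟩ : HodgeCM.HermSpace3 F ι'), HodgeCM.HermSpace3.posDef_of_ne (⟨V.Hm, V.isHermitian, sig', pos'⟩ : HodgeCM.HermSpace3 F ι')⟩ Φ' e₁ (frameD (⟨V.Hm, V.isHermitian, sig', pos'⟩ : HodgeCM.HermSpace3 F ι')) (frameD_real (⟨V.Hm, V.isHermitian, sig', pos'⟩ : HodgeCM.HermSpace3 F ι')) (frameD_ne (⟨V.Hm, V.isHermitian, sig', pos'⟩ : HodgeCM.HermSpace3 F ι')) (ιVE (⟨V.Hm, V.isHermitian, sig', pos'⟩ : HodgeCM.HermSpace3 F ι')) (2 * imagUnit (HodgeCM.CMField.K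 F))⁻¹ (fun _ _ => (Rep.update ↥(maximalRealSubfield (HodgeCM.CMField.K F)) (imagUnitSq (HodgeCM.CMField.K F)) (Rep.ofLineOf ↥(maximalRealSubfield (HodgeCM.CMField.K F)) (imagUnitSq (HodgeCM.CMField.K F))) (locF ↥(maximalRealSubfield (HodgeCM.CMField.K F)) (imagUnitSq (HodgeCM.CMField.K F)) (realUnit ⟨HodgeCM.CMField.K F⟩ a.1 a.2.1 a.2.2)) (realUnit ⟨HodgeCM.CMField.K F⟩ a.1 a.2.1 a.2.2) rfl)))) H rhoB →
      BettiThetaDecomposition (Summit.HodgeConjecture.CorCM.D2Bridge.AdapterMuConj.muConj (uniformOmegaRep h ⟨HodgeCM.CMField.K F⟩ ι₁ ⟨HodgeCM.HermSpace3.Hm V, HodgeCM.HermSpace3.isHermitian V, HodgeCM.HermSpace3.signature_ι₁ V, HodgeCM.HermSpace3.posDef_of_ne V⟩ Φ e₁ (frameD V) (frameD_real V) (frameD_ne V) (ιVE V) (2 * imagUnit (HodgeCM.CMField.K F))⁻¹ (fun _ _ => (Rep.update ↥(maximalRealSubfield (HodgeCM.CMField.K F)) (imagUnitSq (HodgeCM.CMField.K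 F)) (Rep.ofLineOf ↥(maximalRealSubfield (HodgeCM.CMField.K F)) (imagUnitSq (HodgeCM.CMField.K F))) (locF ↥(maximalRealSubfield (HodgeCM.CMField.K F)) (imagUnitSq (HodgeCM.CMField.K F)) (realUnit ⟨HodgeCM.CMField.K F⟩ a.1 a.2.1 a.2.2)) (realUnit ⟨HodgeCM.CMField.K F⟩ a.1 a.2.1 a.2.2) rfl)))) H rhoB :=
  fun hdec => by
  -- pin `U` (from `hdec`) and `U'` (from the goal) first; only then are the identity structure maps elaborated
  refine BettiThetaDecomposition.transport _ _ ?_ ?_ ?_ ?_ ?_ ?_ ?_ hdec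
  · exact MonoidHom.id _
  · exact Equiv.refl _
  · exact Equiv.refl _
  · exact fun _ => rfl
  · exact fun _ _ _ _ => LinearEquiv.refl ℂ _
  · exact fun _ _ _ _ _ _ => rfl
  · exact fun _ _ => rfl

set_option synthInstance.maxHeartbeats 400000 in
set_option maxHeartbeats 4000000 in
-- (as above, the other direction)
/-- **The converse re-reading** (same proof with the faces exchanged): a decomposition over `muConj 𝕌` of `(ι₁, V, a, Φ)` is one over
`muConj 𝕌` of `(ι', ⟨V.Hm, V.isHermitian, sig', pos'⟩, a, Φ')`. [cite: Liu2021, Prop. 4.13 (FJcycle.tex l. 2110–2131); Def. 4.11–4.12] -/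
theorem bettiThetaDecomposition_to_sameGram
    (rhoB : Representation ℂ (sec42DataOf h isoOf ⟨HodgeCM.CMField.K F⟩ ι₁ ⟨HodgeCM.HermSpace3.Hm V, HodgeCM.HermSpace3.isHermitian V, HodgeCM.HermSpace3.signature_ι₁ V, HodgeCM.HermSpace3.posDef_of_ne V⟩ Φ).G H) :
    BettiThetaDecomposition (Summit.HodgeConjecture.CorCM.D2Bridge.AdapterMuConj.muConj (uniformOmegaRep h ⟨HodgeCM.CMField.K F⟩ ι₁ ⟨HodgeCM.HermSpace3.Hm V, HodgeCM.HermSpace3.isHermitian V, HodgeCM.HermSpace3.signature_ι₁ V, HodgeCM.HermSpace3.posDef_of_ne V⟩ Φ e₁ (frameD V) (frameD_real V) (frameD_ne V) (ιVE V) (2 * imagUnit (HodgeCM.CMField.K F))⁻¹ (fun _ _ => (Rep.update ↥(maximalRealSubfield (HodgeCM.CMField.K F)) (imagUnitSq (HodgeCM.CMField.K F)) (Rep.ofLineOf ↥(maximalRealSubfield (HodgeCM.CMField.K F)) (imagUnitSq (HodgeCM.CMField.K F))) (locF ↥(maximalRealSubfield (HodgeCM.CMField.K F)) (imagUnitSq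 (HodgeCM.CMField.K F)) (realUnit ⟨HodgeCM.CMField.K F⟩ a.1 a.2.1 a.2.2)) (realUnit ⟨HodgeCM.CMField.K F⟩ a.1 a.2.1 a.2.2) rfl)))) H rhoB →
      BettiThetaDecomposition (Summit.HodgeConjecture.CorCM.D2Bridge.AdapterMuConj.muConj (uniformOmegaRep h ⟨HodgeCM.CMField.K F⟩ ι' ⟨HodgeCM.HermSpace3.Hm (⟨V.Hm, V.isHermitian, sig', pos'⟩ : HodgeCM.HermSpace3 F ι'), HodgeCM.HermSpace3.isHermitian (⟨V.Hm, V.isHermitian, sig', pos'⟩ : HodgeCM.HermSpace3 F ι'), HodgeCM.HermSpace3.signature_ι₁ (⟨V.Hm, V.isHermitian, sig', pos'⟩ : HodgeCM.HermSpace3 F ι'), HodgeCM.HermSpace3.posDef_of_ne (⟨V.Hm, V.isHermitian, sig', pos'⟩ : HodgeCM.HermSpace3 F ι')⟩ Φ' e₁ (frameD (⟨V.Hm, V.isHermitian, sig', pos'⟩ : HodgeCM.HermSpace3 F ι')) (frameD_real (⟨V.Hm, V.isHermitian, sig', pos'⟩ : HodgeCM.HermSpace3 F ι')) (frameD_ne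 (⟨V.Hm, V.isHermitian, sig', pos'⟩ : HodgeCM.HermSpace3 F ι')) (ιVE (⟨V.Hm, V.isHermitian, sig', pos'⟩ : HodgeCM.HermSpace3 F ι')) (2 * imagUnit (HodgeCM.CMField.K F))⁻¹ (fun _ _ => (Rep.update ↥(maximalRealSubfield (HodgeCM.CMField.K F)) (imagUnitSq (HodgeCM.CMField.K F)) (Rep.ofLineOf ↥(maximalRealSubfield (HodgeCM.CMField.K F)) (imagUnitSq (HodgeCM.CMField.K F))) (locF ↥(maximalRealSubfield (HodgeCM.CMField.K F)) (imagUnitSq (HodgeCM.CMField.K F)) (realUnit ⟨HodgeCM.CMField.K F⟩ a.1 a.2.1 a.2.2)) (realUnit ⟨HodgeCM.CMField.K F⟩ a.1 a.2.1 a.2.2) rfl)))) H rhoB :=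
  fun hdec => by
  -- pin `U` (from `hdec`) and `U'` (from the goal) first; only then are the identity structure maps elaborated
  refine BettiThetaDecomposition.transport _ _ ?_ ?_ ?_ ?_ ?_ ?_ ?_ hdec
  · exact MonoidHom.id _
  · exact Equiv.refl _
  · exact Equiv.refl _
  · exact fun _ => rfl
  · exact fun _ _ _ _ => LinearEquiv.refl ℂ _
  · exact fun _ _ _ _ _ _ => rfl
  · exact fun _ _ => rfl

end SameGram

/-! ## §3. By name at the flipped face `V.alongConj` (A-p02's FILE B `OffPlaceFace`, p605947) -/

section AlongConj

variable (h : exists_recordSystem) (F : HodgeCM.CMField) [IsGalois ℚ F] {ι₁ : (F : Type) →+* ℂ} (V : HodgeCM.HermSpace3 F ι₁)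
  (a : RealScalar F) (Φ Φ' : CMType F) (H : Type) [AddCommGroup H] [Module ℂ H]

set_option synthInstance.maxHeartbeats 400000 in
set_option maxHeartbeats 4000000 in
-- (`V.alongConj` IS the literal same-Gram structure `⟨V.Hm, V.isHermitian, _, _⟩` at `conj ∘ ι₁`: `bettiThetaDecomposition_of_sameGram` by unification)
/-- **Stub P's Weil-carrier side at the flipped face, BY NAME.**  For `V₀ := V.alongConj` (the same Gram matrix read at `conj ∘ ι₁`, FILE B) and
ANY CM types `Φ`, `Φ'` (D4 takes `Φ' := Φ̄ ∋ conj ∘ ι₁`): a [Prop 4.13] decomposition of `(H, rhoB)` over `muConj 𝕌` of the face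
`(conj ∘ ι₁, V.alongConj, a, Φ')` is one over `muConj 𝕌` of `(ι₁, V, a, Φ)` — same carriers term by term, only the index type re-read.
[cite: Liu2021, Prop. 4.13 (FJcycle.tex l. 2110–2131); Def. 4.11–4.12; §4.2 l. 2053–2060] -/
theorem bettiThetaDecomposition_of_alongConj
    (rhoB : Representation ℂ (sec42DataOf h isoOf ⟨HodgeCM.CMField.K F⟩ ι₁ ⟨HodgeCM.HermSpace3.Hm V, HodgeCM.HermSpace3.isHermitian V, HodgeCM.HermSpace3.signature_ι₁ V, HodgeCM.HermSpace3.posDef_of_ne V⟩ Φ).G H) :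
    BettiThetaDecomposition (Summit.HodgeConjecture.CorCM.D2Bridge.AdapterMuConj.muConj (uniformOmegaRep h ⟨HodgeCM.CMField.K F⟩ ((starRingEnd ℂ).comp ι₁) ⟨HodgeCM.HermSpace3.Hm V.alongConj, HodgeCM.HermSpace3.isHermitian V.alongConj, HodgeCM.HermSpace3.signature_ι₁ V.alongConj, HodgeCM.HermSpace3.posDef_of_ne V.alongConj⟩ Φ' e₁ (frameD V.alongConj) (frameD_real V.alongConj) (frameD_ne V.alongConj) (ιVE V.alongConj) (2 * imagUnit (HodgeCM.CMField.K F))⁻¹ (fun _ _ => (Rep.update ↥(maximalRealSubfield (HodgeCM.CMField.K F)) (imagUnitSq (HodgeCM.CMField.K F)) (Rep.ofLineOf ↥(maximalRealSubfield (HodgeCM.CMField.K F)) (imagUnitSq (HodgeCM.CMField.K F))) (locF ↥(maximalRealSubfield (HodgeCM.CMField.K F)) (imagUnitSq (HodgeCM.CMField.K F)) (realUnit ⟨HodgeCM.CMField.K F⟩ a.1 a.2.1 a.2.2)) (realUnit ⟨HodgeCM.CMField.K F⟩ a.1 a.2.1 a.2.2) rfl)))) H rhoB →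
      BettiThetaDecomposition (Summit.HodgeConjecture.CorCM.D2Bridge.AdapterMuConj.muConj (uniformOmegaRep h ⟨HodgeCM.CMField.K F⟩ ι₁ ⟨HodgeCM.HermSpace3.Hm V, HodgeCM.HermSpace3.isHermitian V, HodgeCM.HermSpace3.signature_ι₁ V, HodgeCM.HermSpace3.posDef_of_ne V⟩ Φ e₁ (frameD V) (frameD_real V) (frameD_ne V) (ιVE V) (2 * imagUnit (HodgeCM.CMField.K F))⁻¹ (fun _ _ => (Rep.update ↥(maximalRealSubfield (HodgeCM.CMField.K F)) (imagUnitSq (HodgeCM.CMField.K F)) (Rep.ofLineOf ↥(maximalRealSubfield (HodgeCM.CMField.K F)) (imagUnitSq (HodgeCM.CMField.K F))) (locF ↥(maximalRealSubfield (HodgeCM.CMField.K F)) (imagUnitSq (HodgeCM.CMField.K F)) (realUnit ⟨HodgeCM.CMField.K F⟩ a.1 a.2.1 a.2.2)) (realUnit ⟨HodgeCM.CMField.K F⟩ a.1 a.2.1 a.2.2) rfl)))) H rhoB :=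
  bettiThetaDecomposition_of_sameGram h F V V.alongConj.signature_ι₁ V.alongConj.posDef_of_ne a Φ Φ' H rhoB

set_option synthInstance.maxHeartbeats 400000 in
set_option maxHeartbeats 4000000 in
-- (as above, the other direction)
/-- **The converse at the flipped face, BY NAME**: a decomposition over `muConj 𝕌` of `(ι₁, V, a, Φ)` is one over `muConj 𝕌` of
`(conj ∘ ι₁, V.alongConj, a, Φ')`. [cite: Liu2021, Prop. 4.13 (FJcycle.tex l. 2110–2131); Def. 4.11–4.12] -/
theorem bettiThetaDecomposition_to_alongConj
    (rhoB : Representation ℂ (sec42DataOf h isoOf ⟨HodgeCM.CMField.K F⟩ ι₁ ⟨HodgeCM.HermSpace3.Hm V, HodgeCM.HermSpace3.isHermitian V, HodgeCM.HermSpace3.signature_ι₁ V, HodgeCM.HermSpace3.posDef_of_ne V⟩ Φ).G H) :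
    BettiThetaDecomposition (Summit.HodgeConjecture.CorCM.D2Bridge.AdapterMuConj.muConj (uniformOmegaRep h ⟨HodgeCM.CMField.K F⟩ ι₁ ⟨HodgeCM.HermSpace3.Hm V, HodgeCM.HermSpace3.isHermitian V, HodgeCM.HermSpace3.signature_ι₁ V, HodgeCM.HermSpace3.posDef_of_ne V⟩ Φ e₁ (frameD V) (frameD_real V) (frameD_ne V) (ιVE V) (2 * imagUnit (HodgeCM.CMField.K F))⁻¹ (fun _ _ => (Rep.update ↥(maximalRealSubfield (HodgeCM.CMField.K F)) (imagUnitSq (HodgeCM.CMField.K F)) (Rep.ofLineOf ↥(maximalRealSubfield (HodgeCM.CMField.K F)) (imagUnitSq (HodgeCM.CMField.K F))) (locF ↥(maximalRealSubfield (HodgeCM.CMField.K F)) (imagUnitSq (HodgeCM.CMField.K F)) (realUnit ⟨HodgeCM.CMField.K F⟩ a.1 a.2.1 a.2.2)) (realUnit ⟨HodgeCM.CMField.K F⟩ a.1 a.2.1 a.2.2) rfl)))) H rhoB →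
      BettiThetaDecomposition (Summit.HodgeConjecture.CorCM.D2Bridge.AdapterMuConj.muConj (uniformOmegaRep h ⟨HodgeCM.CMField.K F⟩ ((starRingEnd ℂ).comp ι₁) ⟨HodgeCM.HermSpace3.Hm V.alongConj, HodgeCM.HermSpace3.isHermitian V.alongConj, HodgeCM.HermSpace3.signature_ι₁ V.alongConj, HodgeCM.HermSpace3.posDef_of_ne V.alongConj⟩ Φ' e₁ (frameD V.alongConj) (frameD_real V.alongConj) (frameD_ne V.alongConj) (ιVE V.alongConj) (2 * imagUnit (HodgeCM.CMField.K F))⁻¹ (fun _ _ => (Rep.update ↥(maximalRealSubfield (HodgeCM.CMField.K F)) (imagUnitSq (HodgeCM.CMField.K F)) (Rep.ofLineOf ↥(maximalRealSubfield (HodgeCM.CMField.K F)) (imagUnitSq (HodgeCM.CMField.K F))) (locF ↥(maximalRealSubfield (HodgeCM.CMField.K F)) (imagUnitSq (HodgeCM.CMField.K F)) (realUnit ⟨HodgeCM.CMField.K F⟩ a.1 a.2.1 a.2.2)) (realUnit ⟨HodgeCM.CMField.K F⟩ a.1 a.2.1 a.2.2) rfl)))) H rhoB :=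
  bettiThetaDecomposition_to_sameGram h F V V.alongConj.signature_ι₁ V.alongConj.posDef_of_ne a Φ Φ' H rhoB

end AlongConj

end Summit.HodgeConjecture.CorCM.Lines.A3Liu418

end
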